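/-
Copyright (c) 2026. All rights reserved.
Released under Apache 2.0 license as described in the file LICENSE.
Authors: abc-iut cell, prover seat abc-iut-L4-t6 (gen 14; cell row S3 «ARC-LTIMES-CARRIER», L4-lead m169/m170 (M1)), over this
seat's `⋉`-carrier `archGenuinePlus` and its add-on data (files 1–2), abc-iut-f-101's pinned Cor 5.10 (iv)(b)(c) sufficiency
re-elaborated over the `⋉`-successor by abc-iut-L4-t8 (`Ltimes/LogFrobeniusMonoTelecoreContact.lean`), its necessity half
(`LogFrobeniusMonoTelecorePinned.lean`, abc-iut-L4-t3 / abc-iut-f-101) and abc-iut-L4-t3's N1 (`LogFrobeniusArchPlusNoGo.lean`).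
-/
import Literature.AnabelianGeometry.AbsoluteAnabelian.Ltimes.LogFrobeniusArchGenuinePlusEta
import Literature.AnabelianGeometry.AbsoluteAnabelian.Ltimes.LogFrobeniusMonoTelecoreContact
import Literature.AnabelianGeometry.AbsoluteAnabelian.LogFrobeniusMonoTelecorePinned
import HarnessLib

/-!
# [AbsTopIII] Cor 5.10 (iv)(b)(c), PINNED reading: FALSE at the frozen interface's archimedean chart, TRUE at the
# `⋉`-carrier with genuine archimedean `⊞`-side

S. Mochizuki, *Topics in absolute anabelian geometry III: global reconstruction algorithms*, J. Math. Sci. Univ.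
Tokyo 22 (2015) 939–1156 [MochizukiAbsTopIII2015]; locators `p.N` = pages of the author's manuscript
(`paper:url-5493eb38cbb7`): Cor 5.10 (iv)(b) p. 147 ("the restrictions `φ^{An⊢⊞}_{v,ν}` … give rise to a telecore structure
`𝔗_{An⊢}`"), Cor 5.10 (iv)(c) p. 148 ("there is a natural isomorphism `η⊢_{v,ν}` from the composite functor determined by the
path `γ¹_{v,ν}` … to the composite functor determined by the path `γ⁰_{v,ν}` … the resulting homotopies `η⊢_{v,ν}`, `(η⊢_{v,ν})⁻¹`,
together with the mono-analyticization homotopies … generate a contact structure `ℋ_{An⊢}` on `𝔗_{An⊢}`"), Def 5.4 (v)/(vii)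
pp. 127–128 and Cor 5.5 (iii) p. 131 (`ι⊞_{v,ε}` on the edges of `Γ⃗^⋉_v`).

## What this file proves (cell row S3, file 3 = the node's M1, L4-lead m170: "the `⋉`-typed arc (b)(c) closer at a genuine
## arc `TH⊞` carrier"; PROOF-ONLY)

`Cor510MonoTelecorePinned` is abc-iut-L4-t3's print-faithful PINNED typing of Cor 5.10 (iv)(b)(c) (a core `An⊢[𝒩⊢⊞]`, the
telecore `𝔗_{An⊢}` with the printed edges, a contact structure `ℋ_{An⊢}` compatible with `𝒥` containing the pinned pairs
`(γ¹_{v,ν}, γ⁰_{v,ν})`), stated verbatim over the frozen interface and over the `⋉`-successor.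

* ★★ `LogFrobeniusSetting.not_cor510MonoTelecorePinned_archGenuineMonoAnChart` — **over the FROZEN interface, at
  abc-iut-w6-d025's archimedean chart** (genuine `ψ = ψArc`: `k∼(G) ≅ ℝ²` at `pre`, `k×(G) ⊃ S¹` at `mult`), over any nonempty
  all-archimedean index and as soon as `𝒞^hol_TF` has an object, **the pinned row is FALSE** — the NODE-LEVEL form of
  abc-iut-L4-t3's N1: the pinned row FORCES the `η⊢`-isomorphisms (`etaMono_iso_of_cor510MonoTelecorePinned`, abc-iut-f-101's
  necessity), and two of them transport print's shapes onto the two ends of the frozen `ι⊞`-composite through `k^× ↪ k`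
  (`false_of_tbplus_shapes_arc`);
* ★★★ `LogFrobeniusSettingLtimes.archGenuinePlus_cor510MonoTelecorePinned` — **over the `⋉`-SUCCESSOR, at this seat's carrier
  `archGenuinePlus 𝔄` (same `𝔄`, same holomorphic rows, same `ψArc`; `𝒩⊞_v := 𝒞^hol_{TH⊞}`, `ι⊞` on `Γ⃗^⋉_arc` only), the pinned
  row HOLDS** for `V(F_mod) ≠ ∅`, under abc-iut-w5-d038's orientation cochain: abc-iut-f-101's sufficiency theorem
  (`MonoTelecoreCoherence.cor510MonoTelecorePinned`, re-elaborated over `⋉` by abc-iut-L4-t8) applied to file 2's inhabited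
  add-on `archGenuinePlus_monoTelecoreCoherence`; `…_iff` (`↔ Nonempty Vmod`);
* ★★★ `HolRS.archGenuinePlus_cor510MonoTelecorePinned_geometric` — ZERO HYPOTHESES beyond `V(F_mod) ≠ ∅` at
  `geometricAutHolFieldFunctor Q`, every index set; and the one-line contrast `HolRS.pinned_frozen_false_successor_true`.

HONEST SCOPE: MODEL-LEVEL at a genuine archimedean carrier of OUR `⋉`-successor typing (print unchanged); the carrier's
nonarchimedean places are stand-ins (file 1 (L2)) — the two-sided `⋉`-carrier (abc-iut-f-101's `genuineOpen` restricted along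
`toLtimes` ⊔ `archGenuinePlus`) is the natural sequel; (L-N⊢), (L3)/(L4) of file 1.  Refereed pre-IUT material; nothing here
bears on [IUTchIII] Cor. 3.12; no side taken; a kernel refutation of OUR frozen typing is not a claim about print;
instantiated ≠ endorsed; typed ≠ proved.
-/

set_option autoImplicit false

universe u

open CategoryTheory

namespace Literature.AnabelianGeometry.AbsoluteAnabelian

/-! ## §1. Frozen interface: the pinned row is FALSE at the archimedean chart -/

namespace LogFrobeniusSetting

variable (𝔄 : AutHolFieldFunctor.{u}) (Vmod : Type (u + 1))

/-- ★★ **Over the FROZEN interface the PINNED Cor 5.10 (iv)(b)(c) is FALSE at abc-iut-w6-d025's archimedean chart**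
(`archGenuineMonoAnChart 𝔄 Vmod (fun _ => true)`: genuine `ψArc`, print's shapes), over a nonempty all-archimedean index, as soon
as `𝒞^hol_TF` has an object: the pinned row forces the `η⊢`-isomorphisms at `pre` and `mult` (abc-iut-f-101's necessity
`etaMono_iso_of_cor510MonoTelecorePinned`), which transport the shapes `k∼(G) ≅ ℝ²`, `k×(G) ⊃ S¹` onto the two ends of the frozen
composite `λ⊞_{mult}(log x) → λ⊞_{space-link}(log x) = λ⊞_{post-log}(log x) → λ⊞_{pre}(x)` read in `TB⊞` — abc-iut-L4-t3's
`false_of_tbplus_shapes_arc`.  (N1 is the same mechanism on the add-on `K`; this is the typed node row.)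
[cite: MochizukiAbsTopIII2015, Cor 5.10 (iv)(c) p. 148] -/
theorem not_cor510MonoTelecorePinned_archGenuineMonoAnChart [Nonempty Vmod] [Nonempty (HolTFPair 𝔄)] :
    ¬ (archGenuineMonoAnChart 𝔄 Vmod (fun _ => true)).Cor510MonoTelecorePinned := by
  intro h
  obtain ⟨v₀⟩ : Nonempty Vmod := inferInstance
  set L := archGenuineMonoAnChart 𝔄 Vmod (fun _ => true)
  obtain ⟨epre⟩ := L.etaMono_iso_of_cor510MonoTelecorePinned h v₀ ArchVertex.pre isCross_arcPre
  obtain ⟨emult⟩ := L.etaMono_iso_of_cor510MonoTelecorePinned h v₀ ArchVertex.mult isCross_arcMult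
  let x : L.X := ULift.up (Classical.arbitrary (HolTFPair 𝔄))
  refine L.false_of_tbplus_shapes_arc v₀
    (L.monoNplus v₀ ⋙ CategoryTheory.Prod.snd TMMono.{u + 1} TBPlus.{u + 1}) x ?_ ?_
  · exact TBPlus.IsCircle.of_iso (archGenuineMonoAnChart_ψ_mult_isCircle 𝔄 Vmod v₀ _)
      ((CategoryTheory.Prod.snd TMMono.{u + 1} TBPlus.{u + 1}).mapIso (emult.app (L.log.obj x)))
  · exact TBPlus.IsPlane.of_iso (archGenuineMonoAnChart_ψ_pre_isPlane 𝔄 Vmod v₀ _)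
      ((CategoryTheory.Prod.snd TMMono.{u + 1} TBPlus.{u + 1}).mapIso (epre.app x))

end LogFrobeniusSetting

/-! ## §2. `⋉`-successor: the pinned row HOLDS at the carrier with genuine archimedean `⊞`-side -/

namespace LogFrobeniusSettingLtimes

variable (𝔄 : AutHolFieldFunctor.{u}) (Vmod : Type (u + 1)) (isArc : Vmod → Bool)

/-- ★★★ **[AbsTopIII] Cor 5.10 (iv)(b)(c), PINNED reading, HOLDS at the `⋉`-carrier with genuine archimedean `⊞`-side** for
`V(F_mod) ≠ ∅`, under abc-iut-w5-d038's orientation cochain: the mono-analytic telecore `𝔗_{An⊢}` (edges the genuine `ψArc`) and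
a contact structure `ℋ_{An⊢}` compatible with `𝒥` containing the pinned pairs `(γ¹_{v,ν}, γ⁰_{v,ν})` EXIST there — abc-iut-f-101's
sufficiency theorem over `⋉` (abc-iut-L4-t8's `Ltimes/LogFrobeniusMonoTelecoreContact.lean`) fed with file 2's inhabited add-on.
[cite: MochizukiAbsTopIII2015, Cor 5.10 (iv)(b)(c) pp. 147–148] -/
theorem archGenuinePlus_cor510MonoTelecorePinned [Nonempty Vmod] (c : 𝔄.EA → ℝ) (hc : ∀ X : 𝔄.EA, c X = 1 ∨ c X = -1)
    (hcob : ∀ {X Y : 𝔄.EA} (f : X ⟶ Y), AutHolFieldFunctor.transitionSign f = c X * c Y) :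
    (archGenuinePlus 𝔄 Vmod isArc).Cor510MonoTelecorePinned :=
  (archGenuinePlus_monoTelecoreCoherence 𝔄 Vmod isArc c hc hcob).cor510MonoTelecorePinned

/-- Existence form: an orientation cochain for the transition signs of `𝔄` gives the pinned row at the carrier, for
`V(F_mod) ≠ ∅`. [cite: MochizukiAbsTopIII2015, Cor 5.10 (iv)(b)(c) pp. 147–148] -/
theorem archGenuinePlus_cor510MonoTelecorePinned_of_cochain [Nonempty Vmod]
    (h : ∃ c : 𝔄.EA → ℝ, (∀ X, c X = 1 ∨ c X = -1) ∧
      ∀ {X Y : 𝔄.EA} (f : X ⟶ Y), AutHolFieldFunctor.transitionSign f = c X * c Y) :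
    (archGenuinePlus 𝔄 Vmod isArc).Cor510MonoTelecorePinned := by
  obtain ⟨c, hc, hcob⟩ := h
  exact archGenuinePlus_cor510MonoTelecorePinned 𝔄 Vmod isArc c hc hcob

/-- **The pinned row at the carrier, EXACTLY** (given a cochain): it holds iff `V(F_mod) ≠ ∅` (abc-iut-f-101's
`MonoTelecoreCoherence.cor510MonoTelecorePinned_iff` over `⋉`). [cite: MochizukiAbsTopIII2015, Cor 5.10 (iv)(b)(c) pp. 147–148] -/
theorem archGenuinePlus_cor510MonoTelecorePinned_iff (c : 𝔄.EA → ℝ) (hc : ∀ X : 𝔄.EA, c X = 1 ∨ c X = -1)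
    (hcob : ∀ {X Y : 𝔄.EA} (f : X ⟶ Y), AutHolFieldFunctor.transitionSign f = c X * c Y) :
    (archGenuinePlus 𝔄 Vmod isArc).Cor510MonoTelecorePinned ↔ Nonempty Vmod :=
  (archGenuinePlus_monoTelecoreCoherence 𝔄 Vmod isArc c hc hcob).cor510MonoTelecorePinned_iff

/-- Bookkeeping form for the node row (L4-lead m170, M1): a `⋉`-carrier over ANY index `(Vmod, isArc)` with `V(F_mod) ≠ ∅` whose
`𝒳` is abc-iut-L4-t2's `𝒞^hol_TF`, whose `⊞`-side is the genuine `𝒞^hol_{TH⊞}` and whose `An⊢[𝒩⊢⊞]` is abc-iut-w6-d025's `AnArc`,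
carrying both add-ons, at which Cor 5.10 (iv)(a) AND the pinned (iv)(b)(c) hold — given an orientation cochain.
[cite: MochizukiAbsTopIII2015, Cor 5.10 (iv) pp. 146–148] -/
theorem exists_arc_ltimes_cor510MonoTelecorePinned [Nonempty Vmod]
    (h : ∃ c : 𝔄.EA → ℝ, (∀ X, c X = 1 ∨ c X = -1) ∧
      ∀ {X Y : 𝔄.EA} (f : X ⟶ Y), AutHolFieldFunctor.transitionSign f = c X * c Y) :
    ∃ (Lt : LogFrobeniusSettingLtimes Vmod isArc) (M : Lt.MonoAnalyticizationHomotopies),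
      Nonempty (Lt.MonoTelecoreCoherence M) ∧ Lt.X = Up (HolTFPair 𝔄) ∧ (∀ v, Lt.Nplus v = Up (HolTHPlusPair 𝔄)) ∧
        Lt.AnMono = TMMono.AnArc.{u + 1} ∧ Lt.Cor510MonoCores ∧ Lt.Cor510MonoTelecorePinned := by
  obtain ⟨c, hc, hcob⟩ := h
  exact ⟨archGenuinePlus 𝔄 Vmod isArc, archGenuinePlus_monoAnalyticizationHomotopies 𝔄 Vmod isArc,
    ⟨archGenuinePlus_monoTelecoreCoherence 𝔄 Vmod isArc c hc hcob⟩, rfl, fun _ => rfl, rfl,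
    archGenuinePlus_cor510MonoCores 𝔄 Vmod isArc, archGenuinePlus_cor510MonoTelecorePinned 𝔄 Vmod isArc c hc hcob⟩

end LogFrobeniusSettingLtimes

/-! ## §3. The geometric case: zero hypotheses; the contrast in one line -/

namespace HolRS

/-- ★★★ **At the geometric Aut-holomorphic field functor of any class `Q` of hyperbolic Riemann surfaces, the PINNED
Cor 5.10 (iv)(b)(c) HOLDS at the `⋉`-carrier with genuine archimedean `⊞`-side, with NO hypothesis beyond `V(F_mod) ≠ ∅`**
(every transition sign is `+1` there, `HolRS.exists_orientationCochain_geometric`).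
[cite: MochizukiAbsTopIII2015, Cor 5.10 (iv)(b)(c) pp. 147–148] -/
theorem archGenuinePlus_cor510MonoTelecorePinned_geometric (Q : ObjectProperty HolRS) (Vmod : Type 1) [Nonempty Vmod]
    (isArc : Vmod → Bool) :
    (LogFrobeniusSettingLtimes.archGenuinePlus (geometricAutHolFieldFunctor Q) Vmod isArc).Cor510MonoTelecorePinned :=
  LogFrobeniusSettingLtimes.archGenuinePlus_cor510MonoTelecorePinned_of_cochain _ Vmod isArc
    (exists_orientationCochain_geometric Q)

/-- ★★ **The contrast in one line, no hypotheses**: at the geometric functor, over a nonempty all-archimedean index with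
`𝒞^hol_TF` nonempty — same `𝔄`, same holomorphic rows, same genuine `ψArc` —, the pinned Cor 5.10 (iv)(b)(c) is FALSE over the
FROZEN interface at abc-iut-w6-d025's arc chart and TRUE over the `⋉`-SUCCESSOR at `archGenuinePlus`: the cell's typing
finding T3g9-F1 (frozen `ι⊞` along `k^× ↪ k` vs. Cor 5.5 (iii)'s `Γ⃗^⋉_v`) read at the NODE ROW, in the kernel, on both sides.
[cite: MochizukiAbsTopIII2015, Cor 5.10 (iv)(c) p. 148] -/
theorem pinned_frozen_false_successor_true (Q : ObjectProperty HolRS) (Vmod : Type 1) [Nonempty Vmod]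
    [Nonempty (HolTFPair (geometricAutHolFieldFunctor Q))] :
    ¬ (LogFrobeniusSetting.archGenuineMonoAnChart (geometricAutHolFieldFunctor Q) Vmod
        (fun _ => true)).Cor510MonoTelecorePinned ∧
      (LogFrobeniusSettingLtimes.archGenuinePlus (geometricAutHolFieldFunctor Q) Vmod
        (fun _ => true)).Cor510MonoTelecorePinned :=
  ⟨LogFrobeniusSetting.not_cor510MonoTelecorePinned_archGenuineMonoAnChart _ Vmod,
    archGenuinePlus_cor510MonoTelecorePinned_geometric Q Vmod (fun _ => true)⟩

end HolRS

end Literature.AnabelianGeometry.AbsoluteAnabelian
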